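import Summits.QuantumFields.YangMills.Theorems.BalabanUVNodesRateCarriersOfRecord13CoPH
import Summits.QuantumFields.YangMills.Theorems.BalabanUVNodesN17AtBetaOfRecordKernels
import Literature.MathematicalPhysics.QuantumFieldTheory.Balaban1983to89.Node00.U3OfKernels

/-!
# BalabanUVNodes ∕ N18 — THE N18 SLOT AT THE KERNEL OBJECTS OF RECORD **IS** NODE N17's HISTORY-MATCHED KERNEL STEP-RATE BINDER
# ON THE BOXES (`Iff`), hence N18 at node00-def-W1's `U3OfKernels.objects` + the (5.10)-class (UD) binder ⟹ the SCALE-SHIFT RATE (NE4 shape)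
# of the merged β `Node00.betaMerged` of the SAME term family, by dag-n17-a's `scaleShiftRate_betaMerged_of_kernelStepRate` BY NAME
# (Track A, DAG node N18 = NE5 `T4OutputRate.NE5 EA EB W κ θ C₅`, in-edge of N17 = NE4; cluster K4 «SpineRates»; key K3⁷ `SpineGivenEndpointR13SepCoPH`)

HONEST FRAMING.  Count-neutral kernel bookkeeping (seat `pub-ymgap-dag-n18-w1` g2; `--supports stmt-QuantumFields-20544`, helper lane), LOCATED:
`N18At` at the kernel objects (the η-rate of consecutive-level LIMITING (1.21) kernels of Bałaban's term family — node N18's content) and the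
(5.10)-class decay (UD) of those kernels are HYPOTHESES here; nothing of Bałaban's is asserted; NE5 ∕ NE4 are NOT PRINTED ([Balaban1987RG1]
Thm 1 p. 259: uniformity in the spacing only; p. 264 β-clause) and NOT PROVED; N18 ∕ N17 NOT discharged; `N17At` ∕ K2⁷'s `N17AtRecord13` are
the n17 lanes' and are NOT touched (this file stops at `ScaleShiftRate … (betaMerged …)`); K3⁷ OPEN, not claimed; counts unmoved.  One finite
four-torus programme at fixed ε — R4 closes the conditional rung `BalabanLadder.UV` only; nothing continuum ∕ ℝ⁴ ∕ OS ∕ mass gap ∕ Clay.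
THEOREMS ONLY: 0 `def`, 0 `sorry`, standard axioms.

THE POINT.  dag-n17-a's kernel road (`…N17AtBetaOfRecordKernels` §17) reduces NE4 for the merged β `β_{k+1}(v) = Σ_x Π_{k+1,01}(v;x) x₀x₁`
(`Π_{k+1}(v;·) := Node00.polLimit F (k+1) (ℰ k v ·) ρ bV`) to two KERNEL binders on the boxes `]0, γ]^{k+1}`: (UD) k-uniform (5.10)-decay and the
HISTORY-MATCHED KERNEL STEP RATE `hS : |Π_{k+2}(w; x) − Π_{k+1}(tail w; x)| ≤ C′θ^k e^{−δ′|x|₁}` (binder `Decay510 (subKernel …) (C′θ^k) δ′`).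
node00-def-W1's kernel objects of node U3 (`Node00/U3OfKernels`, W1-19) STORE exactly these kernels: run A's functional reads `Π_{k+1}(g_0,…,g_k; ·)`,
run B's family `Π_{k+2}(b, g_0,…,g_k; ·)` (`kernelA_extd`, `kernelB_extd_tail`, `kernelB_eq_cons`).  Hence, with `w := (b, g_0, …, g_k)`:
* §1 **`decay510_subKernel_iff_ne5_family`** — for a term family `ℰ`: «NE5 at EVERY member `b ∈ ]0, γ]` between `EA` and `EB b` on the window
  `]0, γ]^ℕ` with letters `(κ, θ, C₅)`» ⟺ «for every `k`, every box history `w ∈ ]0, γ]^{k+2}` and every `(μ, ν)`, `Decay510 (subKernel Π_{k+2}(w) Π_{k+1}(tail w) μ ν)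
  (C₅θ·θ^k) κ`» (⇒: `b := w 0`, `g := extd (tail w)` via `T4BetaReadOut.extd_mem_window`; ⇐: `w := b ∷ (g_0,…,g_k)`); so
  **`n18At_u3OfRecord₁₃_objects_iff_kernelStepRateBox`**: the N18 slot at the ₁₃ bundle `u3OfRecord₁₃ θ (objects F ℰ ρ bV ℓ) k₀` (any index) IS
  node N17's `hS` binder at EVERY direction pair with `C′ := ℓ.C₅·ℓ.θ₅`, `θ := ℓ.θ₅`, `δ′ := ℓ.κ`, `γ′ := θ.γ` — THE TWO NODES' KERNEL CURRENCIES COINCIDE.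
* §2 **`scaleShiftRate_betaMerged_of_n18At_objects`** — N18 at the kernel objects ∧ (UD) (`0 < δ`, `0 < ℓ.κ`) ⟹
  `ScaleShiftRate (betaPrime510 4 (ℓ.C₅·ℓ.θ₅) ℓ.κ) ℓ.θ₅ θ.γ (betaMerged F ℰ ρ bV)` (n17-a's theorem, `hS` := §1); `…_of_decayBound`: (UD) from node U3's
  OWN decay slot `DecayBound (EA …) (Window θ.γ) E₀ δ` (W1-19's `decayBound_EA_iff` + `kernelA_extd`).  So at the kernel reading the K4 edge
  «N18 ⟹ N17's rate half» needs NEITHER N22 NOR the (D4) read-out: histories are matched exactly (`tail`), the `b`-slot IS run B's oldest coupling.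
* §3 AT THE RECORD (`objectsOfRecord₁₃ F N θ ℓ`, the merged term family of record `mergedTermFamilyMatT F N (TβOfRecord₁₃ F N) (chiβOfRecord₁₃ F N θ) θ.εbg`):
  `scaleShiftRate_betaMergedOfRecord_of_n18At_objectsOfRecord₁₃` and the PIN FORM `…_of_kernels_pin` for a reading with `(𝔯.lit …).u3 = objectsOfRecord₁₃ …`
  — the merged β of record (the `betaMerged` inside `betaOfRecord₁₃ = betaOfRecord₈Tχ …`) has the scale-shift rate; composing with `betaOfMerged ∕ beta0OfMerged`
  to reach `betaOfRecord₁₃` itself (the face jump, `Beta0LimitExists`) is n17-a §15 ∕ the n17 lanes' junction, NOT done here.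
NOT COVERED: (UD) and NE5 for Bałaban's kernels (content of rows (5.10) ∕ NE5); `N17At` at the datum; anything off the boxes.

Sources (types only): T. Bałaban, CMP **109** (1987) [Balaban1987RG1] Thm 1 p. 259, (1.20)–(1.22) p. 264, (1.6) p. 261, (5.10) p. 293, §5 p. 298;
C. King, CMP **102** (1986) [King1986] Lemma 4.5 (4.38) p. 674 (the printed A = 0 step-rate template).  Nothing here is a claim about the Yang–Mills mass gap.
-/

noncomputable section

namespace YMDAG.N18.KernelStepRateBoxes

open scoped BigOperators
open Literature.MathematicalPhysics.QuantumFieldTheory.Balaban1983to89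
open Literature.MathematicalPhysics.QuantumFieldTheory.Balaban1983to89.T4Continuum (T4Family ULoop)
open Literature.MathematicalPhysics.QuantumFieldTheory.Balaban1983to89.T4OutputRate (Carriers Functional Window NE5 DecayBound)
open Literature.MathematicalPhysics.QuantumFieldTheory.Balaban1983to89.T4CouplingMatching (ScaleShiftRate)
open Literature.MathematicalPhysics.QuantumFieldTheory.Balaban1983to89.FlowStep (Box mem_box)
open Literature.MathematicalPhysics.QuantumFieldTheory.Balaban1983to89.T4FlagMemory (extd extd_coe tail_mem_box)
open Literature.MathematicalPhysics.QuantumFieldTheory.Balaban1983to89.T4BetaReadOut (extd_mem_window)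
open Literature.MathematicalPhysics.QuantumFieldTheory.Balaban1983to89.B12Sec2to5 (l1 Decay510 betaPrime510)
open Literature.MathematicalPhysics.QuantumFieldTheory.Balaban1983to89.Beta.LimitRate (subKernel subKernel_apply)
open Node00 (prependCoupling U3Letters₁₁ U3Objects₁₁ Stage13Params Stage13HParams TermFamily1 polLimit betaMerged)
open Node00.U3OfKernels (carriers pt kernelA kernelB histPrefix objects objectsOfRecord₁₃ kernelA_extd kernelB_extd_tail kernelA_eq kernelB_eq
  kernelB_eq_cons histPrefix_prependCoupling decayBound_EA_iff)
open Summit.QuantumFields.YangMills.Theorems.BalabanUVNodesN17 (scaleShiftRate_betaMerged_of_kernelStepRate)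
open YMDAG.UVSplit

section Kernels

variable {𝔄 : Type*} [NormedRing 𝔄] [NormedAlgebra ℝ 𝔄]
variable {V : Type*} [NormedAddCommGroup V] [NormedSpace ℝ V] {ι : Type*} [Fintype ι]
variable (F : T4Family) (ℰ : TermFamily1 F 𝔄) (ρ : V →L[ℝ] 𝔄) (bV : Module.Basis ι ℝ V)

/-! ## §1 The N18 family at the kernel objects ⟺ node N17's history-matched kernel step rate on the boxes -/

/-- **NE5 FAMILY ⟹ THE BOXED HISTORY-MATCHED KERNEL STEP RATE** (node N17's `hS` binder, every direction pair): from NE5 at every member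
`b ∈ ]0, γ]` on the window `]0, γ]^ℕ` with letters `(κ, θ, C₅)`, for every box history `w ∈ ]0, γ]^{k+2}`:
`|Π_{k+2}(w; x)_{μν} − Π_{k+1}(tail w; x)_{μν}| ≤ (C₅θ)·θ^k·e^{−κ|x|₁}` — read NE5 at `b := w 0`, `g := extd (tail w)` (a box tail padded by its last
entry lies in the window) at the carrier point `(k, μ, ν, x)`; W1-19's storage faces `kernelA_extd ∕ kernelB_extd_tail` identify the two entries.
[cite: Balaban1987RG1, Thm 1 p.259 and (1.21) p.264] -/
theorem decay510_subKernel_of_ne5_family {γ κ θ C₅ : ℝ}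
    (h : ∀ b : ℝ, 0 < b → b ≤ γ →
      NE5 (Node00.U3OfKernels.EA F ℰ ρ bV) (Node00.U3OfKernels.EB F ℰ ρ bV b) (Window γ) κ θ C₅)
    (k : ℕ) (w : Fin (k + 2) → ℝ) (hw : w ∈ Box γ (k + 1)) (μ ν : Fin 4) :
    Decay510 (subKernel (polLimit F (k + 1 + 1) (fun K => ℰ (k + 1) w K) ρ bV)
      (polLimit F (k + 1) (fun K => ℰ k (Fin.tail w) K) ρ bV) μ ν) (C₅ * θ * θ ^ k) κ := by
  intro x
  have hb : 0 < w 0 ∧ w 0 ≤ γ := (mem_box.mp hw) 0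
  have hg : extd (Fin.tail w) ∈ Window γ := extd_mem_window (tail_mem_box hw)
  have h1 : |Node00.U3OfKernels.EA F ℰ ρ bV (extd (Fin.tail w)) PUnit.unit (pt k μ ν x) -
      Node00.U3OfKernels.EB F ℰ ρ bV (w 0) (extd (Fin.tail w)) PUnit.unit (pt k μ ν x)| ≤
        C₅ * θ ^ (k + 1) * Real.exp (-(κ * l1 x)) :=
    h (w 0) hb.1 hb.2 _ hg PUnit.unit (pt k μ ν x)
  rw [Node00.U3OfKernels.EA_pt, Node00.U3OfKernels.EB_pt, kernelA_extd, kernelB_extd_tail, abs_sub_comm] at h1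
  show |polLimit F (k + 2) (fun K => ℰ (k + 1) w K) ρ bV μ ν x - polLimit F (k + 1) (fun K => ℰ k (Fin.tail w) K) ρ bV μ ν x| ≤
    C₅ * θ * θ ^ k * Real.exp (-κ * l1 x)
  calc |polLimit F (k + 2) (fun K => ℰ (k + 1) w K) ρ bV μ ν x - polLimit F (k + 1) (fun K => ℰ k (Fin.tail w) K) ρ bV μ ν x|
      ≤ C₅ * θ ^ (k + 1) * Real.exp (-(κ * l1 x)) := h1
    _ = C₅ * θ * θ ^ k * Real.exp (-κ * l1 x) := by rw [neg_mul, pow_succ]; ring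

/-- **THE BOXED HISTORY-MATCHED KERNEL STEP RATE ⟹ NE5 AT EVERY MEMBER**: conversely, node N17's `hS` binder at every direction pair with constant
`C₅θ·θ^k` and rate `κ` gives NE5 between run A's kernel functional and EVERY member `b ∈ ]0, γ]` of run B's family on the window — at a sequence `g` and
the point `(k, μ, ν, x)` read `hS` at the box history `w := b ∷ (g_0, …, g_k)` (`kernelB_eq_cons`, `Fin.tail_cons`). [cite: Balaban1987RG1, Thm 1 p.259 and (1.21) p.264] -/
theorem ne5_family_of_decay510_subKernel {γ κ θ C₅ : ℝ}
    (hS : ∀ (k : ℕ) (w : Fin (k + 2) → ℝ), w ∈ Box γ (k + 1) → ∀ μ ν : Fin 4,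
      Decay510 (subKernel (polLimit F (k + 1 + 1) (fun K => ℰ (k + 1) w K) ρ bV)
        (polLimit F (k + 1) (fun K => ℰ k (Fin.tail w) K) ρ bV) μ ν) (C₅ * θ * θ ^ k) κ) :
    ∀ b : ℝ, 0 < b → b ≤ γ →
      NE5 (Node00.U3OfKernels.EA F ℰ ρ bV) (Node00.U3OfKernels.EB F ℰ ρ bV b) (Window γ) κ θ C₅ := by
  rintro b hb hbγ g hg U ⟨k, μ, ν, x⟩
  -- the box history `w := b ∷ (g_0, …, g_k)`
  have hw : (Fin.cons b (histPrefix g k) : Fin (k + 2) → ℝ) ∈ Box γ (k + 1) := by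
    refine mem_box.mpr fun i => ?_
    refine Fin.cases ?_ (fun j => ?_) i
    · simpa using And.intro hb hbγ
    · simpa using hg j
  have h1 := hS k (Fin.cons b (histPrefix g k)) hw μ ν x
  rw [subKernel_apply, Fin.tail_cons, abs_sub_comm] at h1
  show |kernelA F ℰ ρ bV g k μ ν x - kernelB F ℰ ρ bV b g k μ ν x| ≤ C₅ * θ ^ (k + 1) * Real.exp (-(κ * l1 x))
  rw [kernelB_eq_cons, kernelA_eq]
  calc |polLimit F (k + 1) (fun K => ℰ k (histPrefix g k) K) ρ bV μ ν x -
          polLimit F (k + 2) (fun K => ℰ (k + 1) (Fin.cons b (histPrefix g k)) K) ρ bV μ ν x|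
      ≤ C₅ * θ * θ ^ k * Real.exp (-κ * l1 x) := h1
    _ = C₅ * θ ^ (k + 1) * Real.exp (-(κ * l1 x)) := by rw [neg_mul, pow_succ]; ring

/-- **THE TWO CURRENCIES COINCIDE** (`Iff` of the two previous theorems). [cite: Balaban1987RG1, Thm 1 p.259 and (1.21) p.264] -/
theorem decay510_subKernel_iff_ne5_family {γ κ θ C₅ : ℝ} :
    (∀ (k : ℕ) (w : Fin (k + 2) → ℝ), w ∈ Box γ (k + 1) → ∀ μ ν : Fin 4,
      Decay510 (subKernel (polLimit F (k + 1 + 1) (fun K => ℰ (k + 1) w K) ρ bV)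
        (polLimit F (k + 1) (fun K => ℰ k (Fin.tail w) K) ρ bV) μ ν) (C₅ * θ * θ ^ k) κ) ↔
    ∀ b : ℝ, 0 < b → b ≤ γ →
      NE5 (Node00.U3OfKernels.EA F ℰ ρ bV) (Node00.U3OfKernels.EB F ℰ ρ bV b) (Window γ) κ θ C₅ :=
  ⟨ne5_family_of_decay510_subKernel F ℰ ρ bV, fun h k w hw μ ν => decay510_subKernel_of_ne5_family F ℰ ρ bV h k w hw μ ν⟩

variable {N : ℕ} [NeZero N]

/-- **THE N18 SLOT AT THE ₁₃ BUNDLE OF THE KERNEL OBJECTS IS NODE N17's `hS` BINDER** (any run-length index `k₀`): `N18At (u3OfRecord₁₃ θ (objects F ℰ ρ bV ℓ) k₀)`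
⟺ for every `k`, every `w ∈ ]0, θ.γ]^{k+2}`, every `(μ, ν)`: `Decay510 (subKernel Π_{k+2}(w) Π_{k+1}(tail w) μ ν) (ℓ.C₅·ℓ.θ₅·ℓ.θ₅^k) ℓ.κ` — verbatim the
hypothesis `hS` of `…N17.scaleShiftRate_betaMerged_of_kernelStepRate` at `(0, 1)` with `C′ := ℓ.C₅·ℓ.θ₅`, `δ′ := ℓ.κ`.
[cite: Balaban1987RG1, Thm 1 p.259, (1.21)–(1.22) p.264] -/
theorem n18At_u3OfRecord₁₃_objects_iff_kernelStepRateBox (θ : Stage13Params F N) (ℓ : U3Letters₁₁) (k₀ : ℕ) :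
    N18At (u3OfRecord₁₃ θ (objects F ℰ ρ bV ℓ) k₀) ↔
      ∀ (k : ℕ) (w : Fin (k + 2) → ℝ), w ∈ Box θ.γ (k + 1) → ∀ μ ν : Fin 4,
        Decay510 (subKernel (polLimit F (k + 1 + 1) (fun K => ℰ (k + 1) w K) ρ bV)
          (polLimit F (k + 1) (fun K => ℰ k (Fin.tail w) K) ρ bV) μ ν) (ℓ.C₅ * ℓ.θ₅ * ℓ.θ₅ ^ k) ℓ.κ := by
  show (∀ b : ℝ, 0 < b → b ≤ θ.γ →
      NE5 (Node00.U3OfKernels.EA F ℰ ρ bV) (Node00.U3OfKernels.EB F ℰ ρ bV b) (Window θ.γ) ℓ.κ ℓ.θ₅ ℓ.C₅) ↔ _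
  exact (decay510_subKernel_iff_ne5_family F ℰ ρ bV).symm

/-! ## §2 N18 at the kernel objects ∧ (UD) ⟹ the scale-shift rate of the merged β of the SAME term family (n17-a's kernel road BY NAME) -/

/-- **THE SCALE-SHIFT RATE OF THE MERGED β FROM N18 AT THE KERNEL OBJECTS** (NE4 shape for `Node00.betaMerged F ℰ ρ bV`): `N18At` at the ₁₃ bundle of
`objects F ℰ ρ bV ℓ` (any index), `0 < ℓ.κ`, and the (UD) binder — k-uniform (5.10)-decay of the limiting kernels `Π_{k+1,01}(v; ·)` on the boxes, rate
`δ > 0` — give `ScaleShiftRate (betaPrime510 4 (ℓ.C₅·ℓ.θ₅) ℓ.κ) ℓ.θ₅ θ.γ (betaMerged F ℰ ρ bV)`: dag-n17-a's `scaleShiftRate_betaMerged_of_kernelStepRate` with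
`hS :=` §1.  Neither N22 nor the (D4) read-out is used. [cite: Balaban1987RG1, (1.21)–(1.22) p.264 and (5.10) p.293] -/
theorem scaleShiftRate_betaMerged_of_n18At_objects (θ : Stage13Params F N) (ℓ : U3Letters₁₁) (k₀ : ℕ)
    (h18 : N18At (u3OfRecord₁₃ θ (objects F ℰ ρ bV ℓ) k₀)) (hκ : 0 < ℓ.κ) {C δ : ℝ} (hδ : 0 < δ)
    (hU : ∀ (k : ℕ) (v : Fin (k + 1) → ℝ), v ∈ Box θ.γ k → Decay510 (polLimit F (k + 1) (fun K => ℰ k v K) ρ bV 0 1) C δ) :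
    ScaleShiftRate (betaPrime510 4 (ℓ.C₅ * ℓ.θ₅) ℓ.κ) ℓ.θ₅ θ.γ (betaMerged F ℰ ρ bV) :=
  scaleShiftRate_betaMerged_of_kernelStepRate F ℰ ρ bV hδ hκ hU fun k w hw =>
    (n18At_u3OfRecord₁₃_objects_iff_kernelStepRateBox F ℰ ρ bV θ ℓ k₀).1 h18 k w hw 0 1

/-- **(UD) FROM NODE U3's OWN DECAY SLOT**: `DecayBound (EA …) (Window γ) E₀ δ` (the printed (0.25)∕(1.18) form at the kernel objects, uniform constant)
gives the boxed (UD) binder at every direction pair (`decayBound_EA_iff` + `kernelA_extd` at `g := extd v`). [cite: Balaban1987RG1, (1.18) p.263 and (5.10) p.293] -/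
theorem kernelDecayBox_of_decayBound {γ E₀ δ : ℝ} (hU : DecayBound (Node00.U3OfKernels.EA F ℰ ρ bV) (Window γ) E₀ δ)
    (k : ℕ) (v : Fin (k + 1) → ℝ) (hv : v ∈ Box γ k) (μ ν : Fin 4) :
    Decay510 (polLimit F (k + 1) (fun K => ℰ k v K) ρ bV μ ν) E₀ δ := by
  rw [← kernelA_extd]
  exact (decayBound_EA_iff F ℰ ρ bV (Window γ) E₀ δ).1 hU (extd v) (extd_mem_window hv) k μ ν

/-- **THE SCALE-SHIFT RATE OF THE MERGED β FROM N18 AND NODE U3's DECAY SLOT, both at the kernel objects.** [cite: Balaban1987RG1, (1.18) p.263, (1.21)–(1.22) p.264] -/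
theorem scaleShiftRate_betaMerged_of_n18At_objects_of_decayBound (θ : Stage13Params F N) (ℓ : U3Letters₁₁) (k₀ : ℕ)
    (h18 : N18At (u3OfRecord₁₃ θ (objects F ℰ ρ bV ℓ) k₀)) (hκ : 0 < ℓ.κ) {E₀ δ : ℝ} (hδ : 0 < δ)
    (hU : DecayBound (Node00.U3OfKernels.EA F ℰ ρ bV) (Window θ.γ) E₀ δ) :
    ScaleShiftRate (betaPrime510 4 (ℓ.C₅ * ℓ.θ₅) ℓ.κ) ℓ.θ₅ θ.γ (betaMerged F ℰ ρ bV) :=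
  scaleShiftRate_betaMerged_of_n18At_objects F ℰ ρ bV θ ℓ k₀ h18 hκ hδ fun k v hv => kernelDecayBox_of_decayBound F ℰ ρ bV hU k v hv 0 1

/-! ## §2b The boxed kernel step rate — hence N18 at the kernel objects — FROM A FINITE-VOLUME TWO-RUN KERNEL RATE and the (1.21) EXISTENCE -/

/-- **PASSING A TWO-RUN BOUND TO THE (1.21) LIMITS.**  Two `K`-indexed families of finite-volume functionals at scales `j`, `j′` whose windowed kernels
CONVERGE (`Node00.PolLimitExists`, [I] p. 264 «This limit exists» — a NAMED hypothesis, not asserted) and whose windowed kernels at approximations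
`K + s` resp. `K` are EVENTUALLY `B`-close at `(μ, ν, z)` have `B`-close limiting kernels (`le_of_tendsto` along `K → ∞`; the shift `s` is free since
`K + s → ∞`). [cite: Balaban1987RG1, (1.21) p.264] -/
theorem abs_polLimit_sub_polLimit_le_of_eventually {j j' : ℕ}
    (𝓔 : (K : ℕ) → ((Fin (F.P K).d → Site (F.P K) j → 𝔄) → ℝ))
    (𝓔' : (K : ℕ) → ((Fin (F.P K).d → Site (F.P K) j' → 𝔄) → ℝ))
    (h : Node00.PolLimitExists F j 𝓔 ρ bV) (h' : Node00.PolLimitExists F j' 𝓔' ρ bV) (μ ν : Fin 4) (z : Fin 4 → ℤ) (s : ℕ) {B : ℝ}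
    (hK : ∀ᶠ K in Filter.atTop,
      |Node00.polWindow F (K + s) j (𝓔 (K + s)) ρ bV μ ν z - Node00.polWindow F K j' (𝓔' K) ρ bV μ ν z| ≤ B) :
    |polLimit F j 𝓔 ρ bV μ ν z - polLimit F j' 𝓔' ρ bV μ ν z| ≤ B := by
  have t1 := (Node00.tendsto_polLimit F j 𝓔 ρ bV h μ ν z).comp (Filter.tendsto_add_atTop_nat s)
  have t2 := Node00.tendsto_polLimit F j' 𝓔' ρ bV h' μ ν z
  exact le_of_tendsto (t1.sub t2).abs hK

/-- **BOX FORM OF THE (1.21)-EXISTENCE LETTER FROM ITS WINDOW FORM**: existence of the limits along every coupling sequence of the window `]0, γ]^ℕ`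
(the shape `∀ g ∈ Window γ, ∀ k, PolLimitExists F (k+1) (ℰ k (histPrefix g k) ·) ρ bV` of the definers' letters) gives existence at every box history
(`v = histPrefix (extd v) k`, `T4BetaReadOut.extd_mem_window`). [cite: Balaban1987RG1, (1.21) p.264] -/
theorem polLimitExists_box_of_window {γ : ℝ}
    (h : ∀ g ∈ Window γ, ∀ k : ℕ, Node00.PolLimitExists F (k + 1) (fun K => ℰ k (histPrefix g k) K) ρ bV)
    (k : ℕ) (v : Fin (k + 1) → ℝ) (hv : v ∈ Box γ k) :
    Node00.PolLimitExists F (k + 1) (fun K => ℰ k v K) ρ bV := by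
  have h1 := h (extd v) (extd_mem_window hv) k
  rwa [Node00.U3OfKernels.histPrefix_extd] at h1

/-- **THE BOXED KERNEL STEP RATE FROM A FINITE-VOLUME TWO-RUN KERNEL RATE + (1.21) EXISTENCE.**  If on the boxes the (1.21) limits of the term family exist
at every level (`hex`), and for every box history `w ∈ ]0, γ]^{k+2}` the finite-volume windowed kernels of run B (approximation `K + s`, level `k + 2`,
history `w`) and run A (approximation `K`, level `k + 1`, history `tail w`) are EVENTUALLY IN `K` `(C₅θ·θ^k)·e^{−κ|x|₁}`-close (`s = 1`: the two runs on
the SAME torus, started one approximation apart — node U3's pairing), then node N17's boxed step-rate binder holds for the LIMITING kernels.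
[cite: Balaban1987RG1, (1.21) p.264 and Thm 1 p.259] -/
theorem decay510_subKernel_of_finiteVolume {γ κ θ C₅ : ℝ} (s : ℕ)
    (hex : ∀ (k : ℕ) (v : Fin (k + 1) → ℝ), v ∈ Box γ k → Node00.PolLimitExists F (k + 1) (fun K => ℰ k v K) ρ bV)
    (hfin : ∀ (k : ℕ) (w : Fin (k + 2) → ℝ), w ∈ Box γ (k + 1) → ∀ (μ ν : Fin 4) (x : Fin 4 → ℤ), ∀ᶠ K in Filter.atTop,
      |Node00.polWindow F (K + s) (k + 1 + 1) (ℰ (k + 1) w (K + s)) ρ bV μ ν x -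
          Node00.polWindow F K (k + 1) (ℰ k (Fin.tail w) K) ρ bV μ ν x| ≤ C₅ * θ * θ ^ k * Real.exp (-κ * l1 x))
    (k : ℕ) (w : Fin (k + 2) → ℝ) (hw : w ∈ Box γ (k + 1)) (μ ν : Fin 4) :
    Decay510 (subKernel (polLimit F (k + 1 + 1) (fun K => ℰ (k + 1) w K) ρ bV)
      (polLimit F (k + 1) (fun K => ℰ k (Fin.tail w) K) ρ bV) μ ν) (C₅ * θ * θ ^ k) κ :=
  fun x => abs_polLimit_sub_polLimit_le_of_eventually F ρ bV (fun K => ℰ (k + 1) w K) (fun K => ℰ k (Fin.tail w) K)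
    (hex (k + 1) w hw) (hex k (Fin.tail w) (tail_mem_box hw)) μ ν x s (hfin k w hw μ ν x)

/-- **N18 AT THE KERNEL OBJECTS FROM THE FINITE-VOLUME TWO-RUN KERNEL RATE + (1.21) EXISTENCE** (§2b + §1): node N18's slot at the reading of record is
REDUCED to (i) the printed existence of the (1.21) limits on the boxes and (ii) a `K`-eventual η-rate between the finite-volume (1.20) kernels of the
two runs on the same tori — the place where Bałaban's (2.13)-term estimates live.  Both (i), (ii) are hypotheses (node content), not supplied.
[cite: Balaban1987RG1, (1.20)–(1.21) p.264 and Thm 1 p.259] -/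
theorem n18At_u3OfRecord₁₃_objects_of_finiteVolume (θ : Stage13Params F N) (ℓ : U3Letters₁₁) (k₀ s : ℕ)
    (hex : ∀ (k : ℕ) (v : Fin (k + 1) → ℝ), v ∈ Box θ.γ k → Node00.PolLimitExists F (k + 1) (fun K => ℰ k v K) ρ bV)
    (hfin : ∀ (k : ℕ) (w : Fin (k + 2) → ℝ), w ∈ Box θ.γ (k + 1) → ∀ (μ ν : Fin 4) (x : Fin 4 → ℤ), ∀ᶠ K in Filter.atTop,
      |Node00.polWindow F (K + s) (k + 1 + 1) (ℰ (k + 1) w (K + s)) ρ bV μ ν x -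
          Node00.polWindow F K (k + 1) (ℰ k (Fin.tail w) K) ρ bV μ ν x| ≤ ℓ.C₅ * ℓ.θ₅ * ℓ.θ₅ ^ k * Real.exp (-ℓ.κ * l1 x)) :
    N18At (u3OfRecord₁₃ θ (objects F ℰ ρ bV ℓ) k₀) :=
  (n18At_u3OfRecord₁₃_objects_iff_kernelStepRateBox F ℰ ρ bV θ ℓ k₀).2 (decay510_subKernel_of_finiteVolume F ℰ ρ bV s hex hfin)

end Kernels

/-! ## §3 At the record, Stage 13: the merged β OF RECORD has the scale-shift rate, from N18 at `objectsOfRecord₁₃` and (UD); the pin form -/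

section Record

open scoped Matrix.Norms.L2Operator

variable (F : T4Family) (N : ℕ) [NeZero N]

/-- **THE SCALE-SHIFT RATE OF THE MERGED β OF RECORD** (the `betaMerged` of the merged term family of record, i.e. the one inside
`betaOfRecord₁₃ F N θ = betaOfRecord₈Tχ …`): from `N18At` at the ₁₃ bundle of `objectsOfRecord₁₃ F N θ ℓ` (any index), `0 < ℓ.κ`, and (UD) for the limiting
kernels of the merged term family of record (§2 at `ℰ :=` that family). [cite: Balaban1987RG1, (1.20)–(1.22) p.264 and (1.6) p.261] -/
theorem scaleShiftRate_betaMergedOfRecord_of_n18At_objectsOfRecord₁₃ (θ : Stage13Params F N) (ℓ : U3Letters₁₁) (k₀ : ℕ)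
    (h18 : N18At (u3OfRecord₁₃ θ (objectsOfRecord₁₃ F N θ ℓ) k₀)) (hκ : 0 < ℓ.κ) {C δ : ℝ} (hδ : 0 < δ)
    (hU : letI := θ.instVβ₁; letI := θ.instVβ₂; letI := θ.instιβ
      ∀ (k : ℕ) (v : Fin (k + 1) → ℝ), v ∈ Box θ.γ k →
        Decay510 (polLimit F (k + 1)
          (fun K => Node00.mergedTermFamilyMatT F N (Node00.TβOfRecord₁₃ F N) (Node00.chiβOfRecord₁₃ F N θ) θ.εbg k v K) θ.ρ8 θ.bV 0 1) C δ) :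
    letI := θ.instVβ₁; letI := θ.instVβ₂; letI := θ.instιβ
    ScaleShiftRate (betaPrime510 4 (ℓ.C₅ * ℓ.θ₅) ℓ.κ) ℓ.θ₅ θ.γ
      (betaMerged F (Node00.mergedTermFamilyMatT F N (Node00.TβOfRecord₁₃ F N) (Node00.chiβOfRecord₁₃ F N θ) θ.εbg) θ.ρ8 θ.bV) := by
  letI := θ.instVβ₁; letI := θ.instVβ₂; letI := θ.instιβ
  have hobj : objectsOfRecord₁₃ F N θ ℓ =
      objects F (Node00.mergedTermFamilyMatT F N (Node00.TβOfRecord₁₃ F N) (Node00.chiβOfRecord₁₃ F N θ) θ.εbg) θ.ρ8 θ.bV ℓ := rfl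
  rw [hobj] at h18
  exact scaleShiftRate_betaMerged_of_n18At_objects F _ θ.ρ8 θ.bV θ ℓ k₀ h18 hκ hδ hU

variable {N}

/-- **PIN FORM** (the shape a `stub_rates13H` ∕ `N17AtRecord13` prover meets): for a Stage-13 reading whose node-U3 objects at a tuple ARE the kernel
objects of record (`hpin`), the N18 conjunct at ANY run-length bundle `(rateCarriersOfRecord₁₃CoPH 𝔯 F θ hP g₀ os k₀).u3` together with (UD) and
`0 < ℓ.κ` gives the scale-shift rate of the merged β of record. [cite: Balaban1987RG1, (1.20)–(1.22) p.264] -/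
theorem scaleShiftRate_betaMergedOfRecord_of_kernels_pin (𝔯 : RateReading₁₃CoPH N) (θ : Stage13HParams F N)
    (hP : θ.Provisos₁₃CoPH F N) (g₀ : ℕ → ℝ) (os : List (ULoop F)) (ℓ : U3Letters₁₁)
    (hpin : (𝔯.lit F θ hP g₀ os).u3 = objectsOfRecord₁₃ F N θ.toStage13Params ℓ) (k₀ : ℕ)
    (h18 : N18At (rateCarriersOfRecord₁₃CoPH 𝔯 F θ hP g₀ os k₀).u3) (hκ : 0 < ℓ.κ) {C δ : ℝ} (hδ : 0 < δ)
    (hU : letI := θ.instVβ₁; letI := θ.instVβ₂; letI := θ.instιβ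
      ∀ (k : ℕ) (v : Fin (k + 1) → ℝ), v ∈ Box θ.γ k →
        Decay510 (polLimit F (k + 1)
          (fun K => Node00.mergedTermFamilyMatT F N (Node00.TβOfRecord₁₃ F N) (Node00.chiβOfRecord₁₃ F N θ.toStage13Params) θ.εbg k v K)
          θ.ρ8 θ.bV 0 1) C δ) :
    letI := θ.instVβ₁; letI := θ.instVβ₂; letI := θ.instιβ
    ScaleShiftRate (betaPrime510 4 (ℓ.C₅ * ℓ.θ₅) ℓ.κ) ℓ.θ₅ θ.γ
      (betaMerged F (Node00.mergedTermFamilyMatT F N (Node00.TβOfRecord₁₃ F N) (Node00.chiβOfRecord₁₃ F N θ.toStage13Params) θ.εbg)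
        θ.ρ8 θ.bV) := by
  change N18At (u3OfRecord₁₃ θ.toStage13Params (𝔯.lit F θ hP g₀ os).u3 k₀) at h18
  rw [hpin] at h18
  exact scaleShiftRate_betaMergedOfRecord_of_n18At_objectsOfRecord₁₃ F N θ.toStage13Params ℓ k₀ h18 hκ hδ hU

end Record

/-! ## §4 (v1.1) At the record and under the reading pin: N18 FROM THE FINITE-VOLUME TWO-RUN KERNEL RATE OF THE MERGED TERM OF RECORD + (1.21) EXISTENCE -/

section RecordFiniteVolume

open scoped Matrix.Norms.L2Operator

variable (F : T4Family) (N : ℕ) [NeZero N]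

/-- **N18 AT THE OBJECTS OF RECORD FROM FINITE VOLUME** (§2b at the merged term family of record): (i) the (1.21) limits of the merged term of record
EXIST along every coupling sequence of the window `]0, θ.γ]^ℕ` (the WINDOW form of the existence letter — the definers' `PolLimitsExist … (Window θ.γ)`
shape, unfolded), and (ii) the finite-volume (1.20) kernels of run B (approximation `K + s`, level `k + 2`, box history `w`) and run A (approximation `K`,
level `k + 1`, history `tail w`) of THAT family are `K`-eventually `(ℓ.C₅ℓ.θ₅)·ℓ.θ₅^k·e^{−ℓ.κ|x|₁}`-close ⟹ `N18At (u3OfRecord₁₃ θ (objectsOfRecord₁₃ F N θ ℓ) k₀)`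
(every index).  Both (i), (ii) are hypotheses on Bałaban's merged term (1.6) — NOT supplied. [cite: Balaban1987RG1, (1.20)–(1.21) p.264 and (1.6) p.261] -/
theorem n18At_u3OfRecord₁₃_objectsOfRecord₁₃_of_finiteVolume (θ : Stage13Params F N) (ℓ : U3Letters₁₁) (k₀ s : ℕ)
    (hex : letI := θ.instVβ₁; letI := θ.instVβ₂; letI := θ.instιβ
      ∀ g ∈ Window θ.γ, ∀ k : ℕ, Node00.PolLimitExists F (k + 1)
        (fun K => Node00.mergedTermFamilyMatT F N (Node00.TβOfRecord₁₃ F N) (Node00.chiβOfRecord₁₃ F N θ) θ.εbg k (histPrefix g k) K)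
        θ.ρ8 θ.bV)
    (hfin : letI := θ.instVβ₁; letI := θ.instVβ₂; letI := θ.instιβ
      ∀ (k : ℕ) (w : Fin (k + 2) → ℝ), w ∈ Box θ.γ (k + 1) → ∀ (μ ν : Fin 4) (x : Fin 4 → ℤ), ∀ᶠ K in Filter.atTop,
        |Node00.polWindow F (K + s) (k + 1 + 1)
            (Node00.mergedTermFamilyMatT F N (Node00.TβOfRecord₁₃ F N) (Node00.chiβOfRecord₁₃ F N θ) θ.εbg (k + 1) w (K + s)) θ.ρ8 θ.bV μ ν x -
          Node00.polWindow F K (k + 1)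
            (Node00.mergedTermFamilyMatT F N (Node00.TβOfRecord₁₃ F N) (Node00.chiβOfRecord₁₃ F N θ) θ.εbg k (Fin.tail w) K) θ.ρ8 θ.bV μ ν x| ≤
          ℓ.C₅ * ℓ.θ₅ * ℓ.θ₅ ^ k * Real.exp (-ℓ.κ * l1 x)) :
    N18At (u3OfRecord₁₃ θ (objectsOfRecord₁₃ F N θ ℓ) k₀) := by
  letI := θ.instVβ₁; letI := θ.instVβ₂; letI := θ.instιβ
  have hobj : objectsOfRecord₁₃ F N θ ℓ =
      objects F (Node00.mergedTermFamilyMatT F N (Node00.TβOfRecord₁₃ F N) (Node00.chiβOfRecord₁₃ F N θ) θ.εbg) θ.ρ8 θ.bV ℓ := rfl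
  rw [hobj]
  exact n18At_u3OfRecord₁₃_objects_of_finiteVolume F _ θ.ρ8 θ.bV θ ℓ k₀ s (polLimitExists_box_of_window F _ θ.ρ8 θ.bV hex) hfin

variable {N}

/-- **PIN FORM** (the shape a `stub_rates13H` (v3) prover meets under `U3PinnedKernels`): for a reading whose node-U3 objects at the tuple ARE the kernel objects of
record (`hpin`), the N18 conjunct at EVERY run-length bundle `(rateCarriersOfRecord₁₃CoPH 𝔯 F θ hP g₀ os k₀).u3` follows from the window-form (1.21) existence letter and
the finite-volume two-run kernel rate of the merged term of record. [cite: Balaban1987RG1, (1.20)–(1.21) p.264] -/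
theorem n18At_rateCarriers_of_kernels_pin_of_finiteVolume (𝔯 : RateReading₁₃CoPH N) (θ : Stage13HParams F N)
    (hP : θ.Provisos₁₃CoPH F N) (g₀ : ℕ → ℝ) (os : List (ULoop F)) (ℓ : U3Letters₁₁)
    (hpin : (𝔯.lit F θ hP g₀ os).u3 = objectsOfRecord₁₃ F N θ.toStage13Params ℓ) (k₀ s : ℕ)
    (hex : letI := θ.instVβ₁; letI := θ.instVβ₂; letI := θ.instιβ
      ∀ g ∈ Window θ.γ, ∀ k : ℕ, Node00.PolLimitExists F (k + 1)
        (fun K => Node00.mergedTermFamilyMatT F N (Node00.TβOfRecord₁₃ F N) (Node00.chiβOfRecord₁₃ F N θ.toStage13Params) θ.εbg k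
          (histPrefix g k) K) θ.ρ8 θ.bV)
    (hfin : letI := θ.instVβ₁; letI := θ.instVβ₂; letI := θ.instιβ
      ∀ (k : ℕ) (w : Fin (k + 2) → ℝ), w ∈ Box θ.γ (k + 1) → ∀ (μ ν : Fin 4) (x : Fin 4 → ℤ), ∀ᶠ K in Filter.atTop,
        |Node00.polWindow F (K + s) (k + 1 + 1)
            (Node00.mergedTermFamilyMatT F N (Node00.TβOfRecord₁₃ F N) (Node00.chiβOfRecord₁₃ F N θ.toStage13Params) θ.εbg (k + 1) w (K + s))
            θ.ρ8 θ.bV μ ν x -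
          Node00.polWindow F K (k + 1)
            (Node00.mergedTermFamilyMatT F N (Node00.TβOfRecord₁₃ F N) (Node00.chiβOfRecord₁₃ F N θ.toStage13Params) θ.εbg k (Fin.tail w) K)
            θ.ρ8 θ.bV μ ν x| ≤
          ℓ.C₅ * ℓ.θ₅ * ℓ.θ₅ ^ k * Real.exp (-ℓ.κ * l1 x)) :
    N18At (rateCarriersOfRecord₁₃CoPH 𝔯 F θ hP g₀ os k₀).u3 := by
  show N18At (u3OfRecord₁₃ θ.toStage13Params (𝔯.lit F θ hP g₀ os).u3 k₀)
  rw [hpin]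
  exact n18At_u3OfRecord₁₃_objectsOfRecord₁₃_of_finiteVolume F N θ.toStage13Params ℓ k₀ s hex hfin

end RecordFiniteVolume

end YMDAG.N18.KernelStepRateBoxes

end
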